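import Literature.RepresentationTheory.HeisenbergGroup.DoubledDeltaDiagonalInvariance
import HarnessLib

/-!
# The doubled functional `Λ_T = ∫_Δ ∘ (T ⊠ 1)` of an intertwiner: non-vanishing and quasi-invariance
# (piece P1b of the support-form proof of `rankOne_theta_lines_disjoint`)

Topic `RepresentationTheory/HeisenbergGroup`; namespace `Literature.RepresentationTheory.HeisenbergGroup`.  KERNEL ONLY: theorems,
no definition, no named fact, no `sorry`.  Currency of the doubled Schrödinger model of this folder: `𝒮(F^ι) = 𝒮(F^κ) ⊠ 𝒮(F^κ)`
along `e : κ ⊕ κ ≃ ι` (`boxSB`, `sumEndSB`, [`LocalSchwartzBruhatDirectSum`]), complex conjugation `conjSB` / `conjOp`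
(`SchrodingerConjugate`), the diagonal integral `diagIntegral e μ : Φ ↦ ∫ Φ(u ⊔ u) dμ` (`DoubledDeltaFrobenius`,
`DoubledDeltaDiagonalInvariance`).

For a `ℂ`-linear `T : 𝒮(F^κ) → 𝒮(F^κ)` the LINEAR functional `Λ_T := diagIntegral e μ ∘ (T ⊠ 1)` on `𝒮(F^ι)` satisfies

* `diagIntegral_sumEndSB_boxSB_conjSB` — `Λ_T (f ⊠ conj h) = ∫ (T f) · conj h dμ` (the sesquilinear form `⟪T f, h⟫` read as a
  linear functional on the doubled model);
* `diagIntegral_sumEndSB_ne_zero` — `T ≠ 0 ⇒ Λ_T ≠ 0` (`Λ_T (f ⊠ conj (T f)) = ‖T f‖²_{L²} > 0`, `μ` charging open sets);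
* `diagIntegral_sumEndSB_quasiInvariant` — **quasi-invariance**: if `T` intertwines an operator `A₁` with an automorphism `M₂`
  (`T ∘ A₁ = M₂ ∘ T`) and `M₂` is CONFORMALLY `L²`-isometric (`∫ (M₂ f) conj(M₂ h) dμ = r · ∫ f conj h dμ`), then
  `Λ_T ∘ (A₁ ⊠ conjOp M₂) = r · Λ_T`.

With `T` the intertwiner of `TwistedCoinvariantsIsoIntertwiner` (from an isomorphism `Θ_{s₁}(χ₁) ≅ Θ_{s₂}(χ₂)` of rank-one theta
lifts), `A₁ = ω_{s₁}(g)`, `M₂ = ω_{s₂}(g)` (every element of the metaplectic-type group acts as a non-zero scalar times an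
`L²`-isometry), this is the non-zero `ΔU(J)`-quasi-invariant functional of [Liu2021, Lem. D.1 (3)]'s support-form proof (cell
hodgecm-mathlib row IV-4(c1), B-plan1 KEY 2026-08-28, piece P1): the starting point that pieces P2–P6 kill.  Nothing about
unitary groups is in this file; all inputs are explicit binders.

## References
* [MoeglinVignerasWaldspurger1987] C. Mœglin, M.-F. Vignéras, J.-L. Waldspurger, LNM 1291 (1987), Chap. 2 I.7, II.1 (A), II.6 (the
  doubled oscillator `ω ⊗ ω̄` and its diagonal functional).
* [Liu2021] Y. Liu, Camb. J. Math. 9 (2021), App. D Lemma D.1 (3) — the consumer.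
-/

set_option autoImplicit false

noncomputable section

open _root_.MeasureTheory
open scoped ComplexConjugate

namespace Literature.RepresentationTheory.HeisenbergGroup

open Literature.NumberTheory.Automorphic

variable {F : Type*} [Field F] [ValuativeRel F] [TopologicalSpace F] [IsNonarchimedeanLocalField F]
  {κ ι : Type*} [Fintype κ] [Fintype ι] (e : κ ⊕ κ ≃ ι)
  [MeasurableSpace (κ → F)] [BorelSpace (κ → F)] (μ : Measure (κ → F)) [IsFiniteMeasureOnCompacts μ]
  (T : SchwartzBruhat (κ → F) →ₗ[ℂ] SchwartzBruhat (κ → F))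

/-- **`Λ_T (f ⊠ conj h) = ∫ (T f) conj h dμ`**: the functional `diagIntegral ∘ (T ⊠ 1)` on products.
[cite: MoeglinVignerasWaldspurger1987, Chap. 2 I.7] -/
theorem diagIntegral_sumEndSB_boxSB_conjSB (f h : SchwartzBruhat (κ → F)) :
    diagIntegral e μ (sumEndSB F e T LinearMap.id (boxSB F e f (conjSB h))) =
      ∫ u, ((T f : SchwartzBruhat (κ → F)) : (κ → F) → ℂ) u * conj (((h : SchwartzBruhat (κ → F)) : (κ → F) → ℂ) u) ∂μ := by
  rw [sumEndSB_boxSB, LinearMap.id_apply, diagIntegral_boxSB_conjSB]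

/-- **`T ≠ 0 ⇒ Λ_T ≠ 0`**: at `f ⊠ conj (T f)` the functional is `‖T f‖²_{L²(μ)} > 0` (`μ` positive on non-empty open sets).
[cite: MoeglinVignerasWaldspurger1987, Chap. 2 I.7] -/
theorem diagIntegral_sumEndSB_ne_zero [μ.IsOpenPosMeasure] (hT : T ≠ 0) :
    diagIntegral e μ ∘ₗ sumEndSB F e T LinearMap.id ≠ 0 := by
  obtain ⟨f, hf⟩ : ∃ f, T f ≠ 0 := by
    by_contra h
    push Not at h
    exact hT (LinearMap.ext fun f => by rw [h f, LinearMap.zero_apply])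
  intro h0
  have h1 := LinearMap.congr_fun h0 (boxSB F e f (conjSB (T f)))
  rw [LinearMap.comp_apply, LinearMap.zero_apply, sumEndSB_boxSB, LinearMap.id_apply] at h1
  exact diagIntegral_boxSB_conjSB_self_ne_zero e μ hf h1

/-- **Quasi-invariance of `Λ_T`.**  If `T ∘ A₁ = M₂ ∘ T` (an intertwiner from the operator `A₁` to the automorphism `M₂`) and `M₂`
is conformally `L²`-isometric with ratio `r` (`∫ (M₂ f) conj(M₂ h) = r ∫ f conj h` for all `f, h`), then
`Λ_T ∘ (A₁ ⊠ conjOp M₂) = r • Λ_T` — on products: `Λ_T (A₁ f ⊠ conj (M₂ h)) = ∫ M₂(T f) conj(M₂ h) = r ∫ (T f) conj h`.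
(The doubled oscillator `ω ⊗ ω̄` and its diagonal matrix coefficient, [MVW, Chap. 2 II.1 (A), II.6].)
[cite: MoeglinVignerasWaldspurger1987, Chap. 2 II.6] -/
theorem diagIntegral_sumEndSB_quasiInvariant (A₁ : SchwartzBruhat (κ → F) →ₗ[ℂ] SchwartzBruhat (κ → F))
    (M₂ : SchwartzBruhat (κ → F) ≃ₗ[ℂ] SchwartzBruhat (κ → F)) (hTA : T ∘ₗ A₁ = M₂.toLinearMap ∘ₗ T) (r : ℂ)
    (hM₂ : ∀ f h : SchwartzBruhat (κ → F),
      ∫ u, ((M₂ f : SchwartzBruhat (κ → F)) : (κ → F) → ℂ) u * conj (((M₂ h : SchwartzBruhat (κ → F)) : (κ → F) → ℂ) u) ∂μ =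
        r * ∫ u, ((f : SchwartzBruhat (κ → F)) : (κ → F) → ℂ) u * conj (((h : SchwartzBruhat (κ → F)) : (κ → F) → ℂ) u) ∂μ) :
    (diagIntegral e μ ∘ₗ sumEndSB F e T LinearMap.id) ∘ₗ sumEndSB F e A₁ (conjOp M₂).toLinearMap =
      r • (diagIntegral e μ ∘ₗ sumEndSB F e T LinearMap.id) := by
  classical
  refine linearMap_ext_boxSB F e fun f₁ f₂ => ?_
  -- write the second factor as a conjugate
  obtain ⟨h, rfl⟩ : ∃ h, conjSB h = f₂ := ⟨conjSB f₂, conjSB_conjSB f₂⟩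
  rw [LinearMap.comp_apply, LinearMap.comp_apply, sumEndSB_boxSB, LinearEquiv.coe_coe, conjOp_apply, conjSB_conjSB,
    diagIntegral_sumEndSB_boxSB_conjSB, LinearMap.smul_apply, LinearMap.comp_apply, diagIntegral_sumEndSB_boxSB_conjSB,
    smul_eq_mul, ← hM₂]
  -- `T (A₁ f₁) = M₂ (T f₁)`
  have := LinearMap.congr_fun hTA f₁
  rw [LinearMap.comp_apply, LinearMap.comp_apply, LinearEquiv.coe_coe] at this
  rw [this]

end Literature.RepresentationTheory.HeisenbergGroup

end
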